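import Summits.QuantumFields.BalabanUV.T4Continuum.Support.NE3TentMeanDefectPath
import HarnessLib

/-!
# T⁴ programme, node NE3 — row E-MLw-(w4)-P-curved, route H♮, row K5c♯ (file F♯2b): THE ℓ²-ISOMETRIC INTERPOLATION–MEAN DEFECT
# of the covariant tent interpolant — `Σ_z ‖m z − bmeanW M W (tinterpW M W m) z‖² ≤ 4d·D + K♯·S_b`

NE3 (node U1b) formalisation swarm, leaf seat `b2b-balaban-t4-ne3-formalise-leaf-01` (gen 7); row **K5** of ruling ρ-g22-2, sub-row
**K5c♯** = LEVER (4) of the (P♮)_W census (D-ne3r2-g10-2 (4), `HOME/CLAIMS.log` l.20809; INTENT l.20912), file F♯2b over F♯2a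
`NE3TentMeanDefectPath` (weighted convexity, path bound, sharp vertex term).  Summed over the torus with the `2^d` periodic shifts, file 4's
block bound is file 5's internal `2^{3d+2}·d·D`; here the weights are kept (`Σ_T ω_T = 1`) and the shifts are summed PATH BY PATH.

CONTENT ([folklore]; 0 sorry; 0 def), `[Nonempty n]`, `M, N ≥ 1`, `W`, `U` unitary, `SmallField W a`, `SmallField U a_U`, `0 ≤ a, a_U, δ`,
`‖U − bseg M W‖ ≤ δ` bondwise, `U`, `m` `N`-periodic; letters `D = Σ_{z∈periodBox N}Σ_α ‖gaugeDir U m z α‖²`, `S_b = Σ_z ‖m z‖²`: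
§4 `wt_block`, `normSq_offsetDefect_le_sharp` (one block site, weights kept: `≤ Σ_{T⊆univ} ω_T(v)·A(z,T)`, `ω_T(v) = Π_{i∈T}(v_i∕M)·Π_{i∉T}(1 − v_i∕M)`,
   `A(z,T)` = F♯2a's vertex bound), `normSq_sub_bmeanW_tinterpW_le_sharp_block` (Jensen over the `M^d` block sites);
§5 **THE END `sum_normSq_sub_bmeanW_tinterpW_le_sharp`**:
   `Σ_{z∈periodBox N} ‖m z − bmeanW M W (tinterpW M W m) z‖² ≤ 4d·D + (16d²(d−1)²a_U² + 8(9d²M²a + dδ)²)·S_b`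
   against file 5's internal `2^{3d+2}·d·D + 2^d·(2^{2d+4}d²(d−1)²a_U² + 8(9d²M²a + dδ)²)·S_b` — D-coefficient `2^{3d+2}·d ↦ 4d` (×4096 at d = 4).

HONEST FRAMING.  Elementary lattice calculus of OUR interpolant at one background in the small-field class; nothing about Bałaban's
minimisers; (P♮)_W ∕ (ML_w) at W ≠ 1, T-E_w and **NE3 are NOT proved**; spine PROVED 0∕9; finite T⁴ rung (B)+1 — NOT infinite volume, NOT
mass gap, NOT `BetaPertH`, NOT Clay.  PLACEMENT: `Summits/QuantumFields/BalabanUV/`.  HONEST DEPENDENCY (cell page 1): continuum YM on T⁴ ⇐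
BetaPertH ∧ nine spine estimates (0/9 proved); BetaPertH ⇐ (D1) ∧ (D4) ∧ CAP+tail; G-an2-4 gates asym, D1 and NE2/3/4.
-/

set_option autoImplicit false

open scoped BigOperators Matrix.Norms.L2Operator
open Finset

namespace Summit.QuantumFields.BalabanUV.T4Continuum.NE3TentMeanDefectSharp

open Literature.MathematicalPhysics.QuantumFieldTheory.Balaban1983to89
open B7Prop1Explicit B7Prop2Explicit
open T4AveragingDeficitWall (IsUnitaryCfg SmallField Ad)
open T4AveragingDeficitWallBoundary (periodBox mem_periodBox card_periodBox IsPeriodicCfg sum_periodBox_shift)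
open T4AveragingDeficitNonAbelian (Ad_mul)
open AveragingDeficitTransport (norm_Ad_of_unitary)
open AveragingDeficitBlockDensity (btree bseg btree_mem card_offsets_real)
open BlockAveragePushDirGauge (gaugeDir)
open SmoothRefineBlocks (blk res blk_res_eq_of)
open SmoothRefineInterp (indic indic_apply indic_insert interpCore interpCore_insert interpCore_const interp interp_sub wt wt_nonneg
  wt_le_one)
open NE3CoarseInterpolant (blk_block)
open NE3BlockLineAverage (sum_univ_boxVec)
open NE3TangentNoGoWords (dPot)
open NE3TentBump (wt_eq)
open NE3CovariantBlockMean (bmeanW)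
open NE3CoarseFrameData (frameData frameData_self norm_dPot_frameData_cube_le)
open NE3BlockMeanExactInterpolant (normSq_sum_le_card_mul)
open NE3CovariantTentInterpolant (vtxW tinterpW Ad_interp)
open NE3CovariantVertexDefect (norm_vertexDefect_le l1_le_of_abs_le' abs_block_sub_vertex_le abs_block_sub_corner_le
  abs_vertex_sub_corner_le abs_indic_le)

open NE3TentMeanDefectPath (normSq_interp_le_weighted sum_weights_eq_one weights_nonneg normSq_vertexTerm_le_sharp)

noncomputable section

variable {d : ℕ} {n : Type*} [Fintype n] [DecidableEq n] [Nonempty n]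

/-! ## §4 One block site with the weights kept, and the block -/

/-- The offset of a block point is the offset: `wt M (M•z + v) i = v_i∕M` for `v ∈ [0,M)^d`. [folklore] -/
theorem wt_block {M : ℕ} (hM : 1 ≤ M) (z : Site d) {v : Site d} (hv : v ∈ periodBox (d := d) M) (i : Fin d) :
    wt M ((M : ℤ) • z + v) i = ((v i : ℤ) : ℝ) / M := by
  have hvi := fun j => (mem_periodBox.1 hv j)
  rw [wt_eq, (blk_res_eq_of (L := M) hM rfl (fun j => (hvi j).1) (fun j => (hvi j).2)).2]

/-- **THE DEFECT AT ONE BLOCK SITE, WEIGHTS KEPT** (`M ≥ 1`; `y = M•z + v`, `v ∈ [0,M)^d`):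
`‖m z − Ad_{btree_z(y)}(tinterpW M W m y)‖² ≤ Σ_{T⊆univ} ω_T(v)·A(z,T)`, `ω_T(v) = Π_{i∈T}(v_i∕M)·Π_{i∉T}(1 − v_i∕M)`,
`A(z,T)` = the right-hand side of `normSq_vertexTerm_le_sharp`. [folklore] -/
theorem normSq_offsetDefect_le_sharp {M : ℕ} (hM : 1 ≤ M) {W U : Site d → Fin d → (Matrix n n ℂ)ˣ} (hW : IsUnitaryCfg W)
    (hU : IsUnitaryCfg U) {a aU δ : ℝ} (ha : 0 ≤ a) (haU : 0 ≤ aU) (hδ0 : 0 ≤ δ) (hWa : SmallField W a) (hUa : SmallField U aU)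
    (hδ : ∀ (x : Site d) (α : Fin d), ‖((U x α : (Matrix n n ℂ)ˣ) : Matrix n n ℂ) - bseg M W x α‖ ≤ δ)
    (m : Site d → Matrix n n ℂ) (z : Site d) {v : Site d} (hv : v ∈ periodBox (d := d) M) :
    ‖m z - Ad (btree M W z ((M : ℤ) • z + v)) (tinterpW M W m ((M : ℤ) • z + v))‖ ^ 2
      ≤ ∑ T ∈ (Finset.univ : Finset (Fin d)).powerset,
          ((∏ i ∈ T, ((v i : ℤ) : ℝ) / M) * ∏ i ∈ Finset.univ \ T, (1 - ((v i : ℤ) : ℝ) / M))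
            * (2 * ((T.card : ℝ) * ∑ i ∈ T, (2 * ‖gaugeDir U m (z + indic (T.filter (· < i))) i‖ ^ 2
                  + 8 * (((d : ℝ) - 1) * aU) ^ 2 * ‖m (z + indic (T.filter (· < i)))‖ ^ 2))
              + 8 * (9 * (d : ℝ) ^ 2 * (M : ℝ) ^ 2 * a + (d : ℝ) * δ) ^ 2 * ‖m (z + indic T)‖ ^ 2) := by
  have hblk : blk M ((M : ℤ) • z + v) = z := blk_block hM z hv
  have hwt : wt M ((M : ℤ) • z + v) = fun i => ((v i : ℤ) : ℝ) / M := funext fun i => wt_block hM z hv i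
  -- the defect as an interpolant of vertex terms (file 4's identity)
  have hI : m z - Ad (btree M W z ((M : ℤ) • z + v)) (tinterpW M W m ((M : ℤ) • z + v))
      = interp M Finset.univ
          (fun w => m z - Ad (btree M W z ((M : ℤ) • z + v) * (btree M W w ((M : ℤ) • z + v))⁻¹) (m w)) ((M : ℤ) • z + v) := by
    rw [interp_sub]
    unfold tinterpW
    rw [Ad_interp]
    congr 1
    · unfold interp; rw [interpCore_const]
    · congr 1; funext w; rw [vtxW, Ad_mul]
  rw [hI]
  refine (normSq_interp_le_weighted hM _ _ _).trans ?_
  rw [hblk, hwt]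
  refine Finset.sum_le_sum fun T _ => mul_le_mul_of_nonneg_left (normSq_vertexTerm_le_sharp hW hU ha haU hδ0 hWa hUa hδ m z hv T) ?_
  have hvi := fun j => (mem_periodBox.1 hv j)
  have hM0 : (0 : ℝ) < M := by exact_mod_cast (by omega : 0 < M)
  refine weights_nonneg _ _ (fun i => ?_) (fun i => ?_)
  · exact div_nonneg (by exact_mod_cast (hvi i).1) hM0.le
  · rw [div_le_one hM0]; exact_mod_cast (hvi i).2.le

/-- **ONE BLOCK (Jensen over the `M^d` sites), WEIGHTS KEPT** (`M ≥ 1`):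
`‖m z − bmeanW M W (tinterpW M W m) z‖² ≤ (M^d)⁻¹·Σ_{v∈[0,M)^d} Σ_{T⊆univ} ω_T(v)·A(z,T)`. [folklore] -/
theorem normSq_sub_bmeanW_tinterpW_le_sharp_block {M : ℕ} (hM : 1 ≤ M) {W U : Site d → Fin d → (Matrix n n ℂ)ˣ}
    (hW : IsUnitaryCfg W) (hU : IsUnitaryCfg U) {a aU δ : ℝ} (ha : 0 ≤ a) (haU : 0 ≤ aU) (hδ0 : 0 ≤ δ) (hWa : SmallField W a)
    (hUa : SmallField U aU) (hδ : ∀ (x : Site d) (α : Fin d), ‖((U x α : (Matrix n n ℂ)ˣ) : Matrix n n ℂ) - bseg M W x α‖ ≤ δ)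
    (m : Site d → Matrix n n ℂ) (z : Site d) :
    ‖m z - bmeanW M W (tinterpW M W m) z‖ ^ 2
      ≤ ((M : ℝ) ^ d)⁻¹ * ∑ v ∈ periodBox (d := d) M, ∑ T ∈ (Finset.univ : Finset (Fin d)).powerset,
          ((∏ i ∈ T, ((v i : ℤ) : ℝ) / M) * ∏ i ∈ Finset.univ \ T, (1 - ((v i : ℤ) : ℝ) / M))
            * (2 * ((T.card : ℝ) * ∑ i ∈ T, (2 * ‖gaugeDir U m (z + indic (T.filter (· < i))) i‖ ^ 2
                  + 8 * (((d : ℝ) - 1) * aU) ^ 2 * ‖m (z + indic (T.filter (· < i)))‖ ^ 2))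
              + 8 * (9 * (d : ℝ) ^ 2 * (M : ℝ) ^ 2 * a + (d : ℝ) * δ) ^ 2 * ‖m (z + indic T)‖ ^ 2) := by
  have hM0 : (0 : ℝ) < M := by exact_mod_cast (by omega : 0 < M)
  have hX := fun (v : Site d) (hv : v ∈ periodBox (d := d) M) => normSq_offsetDefect_le_sharp hM hW hU ha haU hδ0 hWa hUa hδ m z hv
  have hcard : ((Finset.univ : Finset (Fin d → Fin M)).card : ℝ) = (M : ℝ) ^ d := card_offsets_real M
  have hbm : bmeanW M W (tinterpW M W m) z
      = ∑ r : Fin d → Fin M, (((M : ℝ) ^ d)⁻¹ : ℝ)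
          • Ad (btree M W z ((M : ℤ) • z + boxVec M r)) (tinterpW M W m ((M : ℤ) • z + boxVec M r)) := by
    unfold bmeanW
    refine Finset.sum_congr rfl fun r _ => ?_
    rw [btree, add_sub_cancel_left]
  have hmz : m z = ∑ _r : Fin d → Fin M, (((M : ℝ) ^ d)⁻¹ : ℝ) • m z := by
    rw [Finset.sum_const, ← Nat.cast_smul_eq_nsmul ℝ, hcard, smul_smul, mul_inv_cancel₀ (by positivity), one_smul]
  have hrepr : m z - bmeanW M W (tinterpW M W m) z
      = ∑ r : Fin d → Fin M, (((M : ℝ) ^ d)⁻¹ : ℝ)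
          • (m z - Ad (btree M W z ((M : ℤ) • z + boxVec M r)) (tinterpW M W m ((M : ℤ) • z + boxVec M r))) := by
    have h : m z - bmeanW M W (tinterpW M W m) z
        = (∑ _r : Fin d → Fin M, (((M : ℝ) ^ d)⁻¹ : ℝ) • m z)
          - ∑ r : Fin d → Fin M, (((M : ℝ) ^ d)⁻¹ : ℝ)
              • Ad (btree M W z ((M : ℤ) • z + boxVec M r)) (tinterpW M W m ((M : ℤ) • z + boxVec M r)) := by
      rw [← hmz, hbm]
    rw [h, ← Finset.sum_sub_distrib]
    exact Finset.sum_congr rfl fun r _ => by rw [smul_sub]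
  rw [hrepr]
  refine (normSq_sum_le_card_mul _ _).trans ?_
  rw [hcard, ← sum_univ_boxVec M]
  have hterm : ∀ r : Fin d → Fin M, ‖(((M : ℝ) ^ d)⁻¹ : ℝ)
      • (m z - Ad (btree M W z ((M : ℤ) • z + boxVec M r)) (tinterpW M W m ((M : ℤ) • z + boxVec M r)))‖ ^ 2
      = (((M : ℝ) ^ d)⁻¹) ^ 2 * ‖m z - Ad (btree M W z ((M : ℤ) • z + boxVec M r)) (tinterpW M W m ((M : ℤ) • z + boxVec M r))‖ ^ 2 := by
    intro r; rw [norm_smul, mul_pow, Real.norm_of_nonneg (by positivity)]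
  rw [Finset.sum_congr rfl fun r _ => hterm r, ← Finset.mul_sum, ← mul_assoc,
    show (M : ℝ) ^ d * (((M : ℝ) ^ d)⁻¹) ^ 2 = ((M : ℝ) ^ d)⁻¹ by field_simp]
  refine mul_le_mul_of_nonneg_left (Finset.sum_le_sum fun r _ => hX (boxVec M r) (Finset.mem_image_of_mem _ (Finset.mem_univ r)))
    (by positivity)

/-! ## §5 THE END: the torus sum, shifts path by path -/

/-- **THE ℓ²-ISOMETRIC INTERPOLATION–MEAN DEFECT** (`M, N ≥ 1`; `W`, `U` unitary; `SmallField W a`, `SmallField U a_U`; `0 ≤ a, a_U, δ`;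
`‖U − bseg M W‖ ≤ δ` bondwise; `U`, `m` `N`-periodic; `D = Σ_{z∈periodBox N}Σ_α ‖gaugeDir U m z α‖²`, `S_b = Σ_z ‖m z‖²`):
`Σ_{z∈periodBox N} ‖m z − bmeanW M W (tinterpW M W m) z‖² ≤ 4d·D + (16d²(d−1)²a_U² + 8(9d²M²a + dδ)²)·S_b`. [folklore] -/
theorem sum_normSq_sub_bmeanW_tinterpW_le_sharp {M N : ℕ} (hM : 1 ≤ M) (hN : 1 ≤ N) {W U : Site d → Fin d → (Matrix n n ℂ)ˣ}
    (hW : IsUnitaryCfg W) (hU : IsUnitaryCfg U) {a aU δ : ℝ} (ha : 0 ≤ a) (haU : 0 ≤ aU) (hδ0 : 0 ≤ δ) (hWa : SmallField W a)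
    (hUa : SmallField U aU) (hδ : ∀ (x : Site d) (α : Fin d), ‖((U x α : (Matrix n n ℂ)ˣ) : Matrix n n ℂ) - bseg M W x α‖ ≤ δ)
    (hUP : IsPeriodicCfg U (N : ℤ)) {m : Site d → Matrix n n ℂ} (hm : ∀ (z : Site d) (τ : Fin d), m (z + (N : ℤ) • e τ) = m z) :
    ∑ z ∈ periodBox (d := d) N, ‖m z - bmeanW M W (tinterpW M W m) z‖ ^ 2
      ≤ 4 * (d : ℝ) * ∑ z ∈ periodBox (d := d) N, ∑ α : Fin d, ‖gaugeDir U m z α‖ ^ 2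
        + (16 * (d : ℝ) ^ 2 * (((d : ℝ) - 1) * aU) ^ 2 + 8 * (9 * (d : ℝ) ^ 2 * (M : ℝ) ^ 2 * a + (d : ℝ) * δ) ^ 2)
          * ∑ z ∈ periodBox (d := d) N, ‖m z‖ ^ 2 := by
  have hM0 : (0 : ℝ) < M := by exact_mod_cast (by omega : 0 < M)
  have hd0 : (0 : ℝ) ≤ d := Nat.cast_nonneg d
  -- abbreviations (as equations, not `let`s)
  set D : ℝ := ∑ z ∈ periodBox (d := d) N, ∑ α : Fin d, ‖gaugeDir U m z α‖ ^ 2 with hD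
  set Sb : ℝ := ∑ z ∈ periodBox (d := d) N, ‖m z‖ ^ 2 with hSb
  obtain ⟨Q2, hQ2⟩ : ∃ Q2 : ℝ, Q2 = 8 * (9 * (d : ℝ) ^ 2 * (M : ℝ) ^ 2 * a + (d : ℝ) * δ) ^ 2 := ⟨_, rfl⟩
  obtain ⟨c2, hc2⟩ : ∃ c2 : ℝ, c2 = 8 * (((d : ℝ) - 1) * aU) ^ 2 := ⟨_, rfl⟩
  obtain ⟨A, hA⟩ : ∃ A : Site d → Finset (Fin d) → ℝ, ∀ z T, A z T =
      2 * ((T.card : ℝ) * ∑ i ∈ T, (2 * ‖gaugeDir U m (z + indic (T.filter (· < i))) i‖ ^ 2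
        + c2 * ‖m (z + indic (T.filter (· < i)))‖ ^ 2)) + Q2 * ‖m (z + indic T)‖ ^ 2 := ⟨_, fun _ _ => rfl⟩
  obtain ⟨ω, hω⟩ : ∃ ω : Site d → Finset (Fin d) → ℝ, ∀ v T, ω v T =
      (∏ i ∈ T, ((v i : ℤ) : ℝ) / M) * ∏ i ∈ Finset.univ \ T, (1 - ((v i : ℤ) : ℝ) / M) := ⟨_, fun _ _ => rfl⟩
  have hD0 : 0 ≤ D := Finset.sum_nonneg fun _ _ => Finset.sum_nonneg fun _ _ => sq_nonneg _
  have hSb0 : 0 ≤ Sb := Finset.sum_nonneg fun _ _ => sq_nonneg _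
  have hc20 : 0 ≤ c2 := by rw [hc2]; positivity
  have hQ20 : 0 ≤ Q2 := by rw [hQ2]; positivity
  -- (1) block by block, weights kept
  have hblock : ∀ z : Site d, ‖m z - bmeanW M W (tinterpW M W m) z‖ ^ 2
      ≤ ((M : ℝ) ^ d)⁻¹ * ∑ v ∈ periodBox (d := d) M, ∑ T ∈ (Finset.univ : Finset (Fin d)).powerset, ω v T * A z T := by
    intro z
    have h := normSq_sub_bmeanW_tinterpW_le_sharp_block hM hW hU ha haU hδ0 hWa hUa hδ m z
    simp only [hω, hA, hc2, hQ2]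
    exact h
  -- (2) the shifts, path by path: `Σ_z A z T ≤ 4d·D + (2d²c2 + Q2)·S_b` for every `T`
  have hshiftD : ∀ (S : Finset (Fin d)) (i : Fin d),
      ∑ z ∈ periodBox (d := d) N, ‖gaugeDir U m (z + indic S) i‖ ^ 2 = ∑ z ∈ periodBox (d := d) N, ‖gaugeDir U m z i‖ ^ 2 := by
    intro S i
    refine sum_periodBox_shift N hN (g := fun z => ‖gaugeDir U m z i‖ ^ 2) (fun x κ => ?_) (indic S)
    simp only [gaugeDir]
    rw [hUP x κ i, add_right_comm, hm, hm]
  have hshiftB : ∀ S : Finset (Fin d), ∑ z ∈ periodBox (d := d) N, ‖m (z + indic S)‖ ^ 2 = Sb :=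
    fun S => sum_periodBox_shift N hN (g := fun z => ‖m z‖ ^ 2) (fun x κ => by simp only [hm]) (indic S)
  have hDi : ∀ T : Finset (Fin d), ∑ i ∈ T, ∑ z ∈ periodBox (d := d) N, ‖gaugeDir U m z i‖ ^ 2 ≤ D := by
    intro T
    have hsub : ∑ i ∈ T, ∑ z ∈ periodBox (d := d) N, ‖gaugeDir U m z i‖ ^ 2
        ≤ ∑ i : Fin d, ∑ z ∈ periodBox (d := d) N, ‖gaugeDir U m z i‖ ^ 2 :=
      Finset.sum_le_sum_of_subset_of_nonneg (Finset.subset_univ T)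
        (fun i _ _ => Finset.sum_nonneg fun z _ => sq_nonneg ‖gaugeDir U m z i‖)
    have hcomm : ∑ i : Fin d, ∑ z ∈ periodBox (d := d) N, ‖gaugeDir U m z i‖ ^ 2 = D := by rw [hD, Finset.sum_comm]
    exact hsub.trans hcomm.le
  have hAsum : ∀ T : Finset (Fin d), ∑ z ∈ periodBox (d := d) N, A z T ≤ 4 * (d : ℝ) * D + (2 * (d : ℝ) ^ 2 * c2 + Q2) * Sb := by
    intro T
    have hTn : T.card ≤ d := by simpa using Finset.card_le_univ T
    have hTd : (T.card : ℝ) ≤ d := by exact_mod_cast hTn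
    have hT0 : (0 : ℝ) ≤ T.card := Nat.cast_nonneg _
    -- evaluate the z-sums
    have e1 : ∑ z ∈ periodBox (d := d) N, Q2 * ‖m (z + indic T)‖ ^ 2 = Q2 * Sb := by rw [← Finset.mul_sum, hshiftB]
    have e3 : ∀ i : Fin d, ∑ z ∈ periodBox (d := d) N, (2 * ‖gaugeDir U m (z + indic (T.filter (· < i))) i‖ ^ 2
        + c2 * ‖m (z + indic (T.filter (· < i)))‖ ^ 2)
        = 2 * ∑ z ∈ periodBox (d := d) N, ‖gaugeDir U m z i‖ ^ 2 + c2 * Sb := by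
      intro i
      rw [Finset.sum_add_distrib, ← Finset.mul_sum, ← Finset.mul_sum, hshiftD, hshiftB]
    have e2 : ∑ z ∈ periodBox (d := d) N, 2 * ((T.card : ℝ) * ∑ i ∈ T, (2 * ‖gaugeDir U m (z + indic (T.filter (· < i))) i‖ ^ 2
        + c2 * ‖m (z + indic (T.filter (· < i)))‖ ^ 2))
        = 2 * ((T.card : ℝ) * ∑ i ∈ T, (2 * ∑ z ∈ periodBox (d := d) N, ‖gaugeDir U m z i‖ ^ 2 + c2 * Sb)) := by
      rw [← Finset.mul_sum, ← Finset.mul_sum, Finset.sum_comm]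
      rw [Finset.sum_congr rfl fun i _ => e3 i]
    have hsum : ∑ z ∈ periodBox (d := d) N, A z T
        = 2 * ((T.card : ℝ) * ∑ i ∈ T, (2 * ∑ z ∈ periodBox (d := d) N, ‖gaugeDir U m z i‖ ^ 2 + c2 * Sb)) + Q2 * Sb := by
      rw [Finset.sum_congr rfl fun z _ => hA z T, Finset.sum_add_distrib, e1, e2]
    -- bound them
    have i1 : ∑ i ∈ T, (2 * ∑ z ∈ periodBox (d := d) N, ‖gaugeDir U m z i‖ ^ 2 + c2 * Sb) ≤ 2 * D + (d : ℝ) * (c2 * Sb) := by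
      rw [Finset.sum_add_distrib, ← Finset.mul_sum, Finset.sum_const, nsmul_eq_mul]
      have h1 := hDi T
      nlinarith [mul_le_mul_of_nonneg_right hTd (mul_nonneg hc20 hSb0)]
    have i0 : 0 ≤ ∑ i ∈ T, (2 * ∑ z ∈ periodBox (d := d) N, ‖gaugeDir U m z i‖ ^ 2 + c2 * Sb) :=
      Finset.sum_nonneg fun i _ => add_nonneg
        (mul_nonneg (by norm_num) (Finset.sum_nonneg fun z _ => sq_nonneg ‖gaugeDir U m z i‖)) (mul_nonneg hc20 hSb0)
    have i2 : (T.card : ℝ) * ∑ i ∈ T, (2 * ∑ z ∈ periodBox (d := d) N, ‖gaugeDir U m z i‖ ^ 2 + c2 * Sb)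
        ≤ (d : ℝ) * (2 * D + (d : ℝ) * (c2 * Sb)) := mul_le_mul hTd i1 i0 hd0
    rw [hsum]
    nlinarith [i2]
  -- (3) weights: nonnegative on the block, summing to one
  have hω0 : ∀ v ∈ periodBox (d := d) M, ∀ T : Finset (Fin d), 0 ≤ ω v T := by
    intro v hv T
    have hvi := fun j => (mem_periodBox.1 hv j)
    rw [hω]
    refine weights_nonneg _ _ (fun i => ?_) (fun i => ?_)
    · exact div_nonneg (by exact_mod_cast (hvi i).1) hM0.le
    · rw [div_le_one hM0]; exact_mod_cast (hvi i).2.le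
  have hω1 : ∀ v : Site d, ∑ T ∈ (Finset.univ : Finset (Fin d)).powerset, ω v T = 1 := by
    intro v
    simp only [hω]
    exact sum_weights_eq_one Finset.univ (fun i => ((v i : ℤ) : ℝ) / M)
  -- (4) assemble
  obtain ⟨B, hB⟩ : ∃ B : ℝ, B = 4 * (d : ℝ) * D + (2 * (d : ℝ) ^ 2 * c2 + Q2) * Sb := ⟨_, rfl⟩
  rw [← hB] at hAsum
  have hMd : (0 : ℝ) < (M : ℝ) ^ d := by positivity
  calc ∑ z ∈ periodBox (d := d) N, ‖m z - bmeanW M W (tinterpW M W m) z‖ ^ 2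
      ≤ ∑ z ∈ periodBox (d := d) N, ((M : ℝ) ^ d)⁻¹
          * ∑ v ∈ periodBox (d := d) M, ∑ T ∈ (Finset.univ : Finset (Fin d)).powerset, ω v T * A z T :=
        Finset.sum_le_sum fun z _ => hblock z
    _ = ((M : ℝ) ^ d)⁻¹ * ∑ v ∈ periodBox (d := d) M, ∑ T ∈ (Finset.univ : Finset (Fin d)).powerset,
          ω v T * ∑ z ∈ periodBox (d := d) N, A z T := by
        rw [← Finset.mul_sum, Finset.sum_comm]
        congr 1
        refine Finset.sum_congr rfl fun v _ => ?_
        rw [Finset.sum_comm]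
        exact Finset.sum_congr rfl fun T _ => by rw [Finset.mul_sum]
    _ ≤ ((M : ℝ) ^ d)⁻¹ * ∑ v ∈ periodBox (d := d) M, ∑ T ∈ (Finset.univ : Finset (Fin d)).powerset, ω v T * B := by
        refine mul_le_mul_of_nonneg_left (Finset.sum_le_sum fun v hv => Finset.sum_le_sum fun T _ => ?_) (by positivity)
        exact mul_le_mul_of_nonneg_left (hAsum T) (hω0 v hv T)
    _ = B := by
        rw [Finset.sum_congr rfl fun v _ => by rw [← Finset.sum_mul, hω1 v, one_mul], Finset.sum_const, card_periodBox,
          nsmul_eq_mul]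
        push_cast
        field_simp
    _ = _ := by rw [hB, hQ2, hc2]; ring


end

end Summit.QuantumFields.BalabanUV.T4Continuum.NE3TentMeanDefectSharp
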